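import Summits.ABC.IUTFork.Cor312SettingDHVol
import Summits.ABC.IUTFork.Cor312VolumeVehiclesMono
import HarnessLib

/-!
# [IUTchIII] Cor. 3.12 — the volume-level vehicles' side conditions AT THE ASSEMBLED REAL SETTING WITH THE VERBATIM
# VOLUMES (abc-iut-c312-5's `Real.settingDHVol`): `LogvolMono` proved, `ThetaRegionsAdm` ⟸ hull-set Θ-boxes, `hθ`/`hfinθ` gone

Record-only file (D-0012) of the abc-iut cell (Cor. 3.12 sub-crew, seat abc-iut-c312-6 gen 4; TEAM B support row
«(G1)-vehicle side conditions at the assembled real setting», `HOME/plan/C312-TEAMS.md` §B); PROOF-ONLY; TAKES NO SIDE.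
Companion of `Cor312VolumeVehiclesMono` (the `BridgeHyps`-free vehicles: only `mono` + `ThetaFinite` + `ThetaRegionsAdm`
are consumed) at abc-iut-c312-5's **`Real.settingDHVol`** (`Cor312SettingDHVol`: the Dupuy–Hilado-level real log-shells
of a number field `F` WITH THE VERBATIM weighted container `𝕄(−)`/`μ^log` of [IUTchIII] Rmk. 3.1.1 (ii)(iii)):
`LogvolMono` PROVED (`SummandPieces.logvolMono_of_realizes` ∘ `realizes_situationDHVol`), `ThetaRegionsAdm` ⟸ «the
Θ-boxes of the Θ-pilot object are hull-sets `λ·𝒪_L`» (abc-iut-c312-5 `hadm_DH`; [IUTchIII] Rmk. 3.9.5 (ii)/(ix)), whence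
**`Real.statement_settingDHVol_of_volumeTransport(At)` / `_of_globalVolumeTransport(At)`**: the printed Statement at this
setting from {hull-set Θ-boxes (shape of the binder `thetaBox`), `ThetaFinite` (= Statement.1; its compactness clause is
discharged by abc-iut-c312-5's `Cor312HullDefinedDHVol` / `Cor312ThetaFiniteDHVol`, p417967 / p419718:
`Real.thetaFinite_settingDHVol`, a one-line composition away), the B-INPUT (GAP-LEDGER G-c312-11-1 family)}. The residuals `hθ`/`hfinθ` of
`bridgeHyps_settingDHVol` (admissibility / finite support of the (Ind3)-UNION — FALSE for coordinate-separated
`m`-varying images, abc-iut-w5-d060 p416677; TRUE for `m`-constant boxes, abc-iut-w5-d235 p415228 / abc-iut-c312-3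
`Cor312ThetaBoxesDH`) do not occur. [claim: Mochizuki2012, status: disputed] for the quoted setting. Deliberately NOT
here: any instance of the B-INPUT, any judgement. Typed ≠ proved; instantiated ≠ endorsed.
-/

noncomputable section

open Set Function

namespace Summit.ABC

namespace IUTFork

/-! ## 3. At `Real.settingDHVol` — the real Dupuy–Hilado log-shells WITH THE VERBATIM VOLUMES (abc-iut-c312-5) -/

namespace Thm311

namespace Real

open Cor312 Cor312Vol Literature.IUT.LogThetaLattice Literature.IUT.LogVolume

variable {F : Type} [Field F] [NumberField F] (X : PilotData F) {logv : PadicLogs F} (hlog : LogvAnalytic logv)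
  (M : Type) [Field M] [NumberField M]
  (archPk : ∀ (j : (thetaIndex X).Label) (vQ : (thetaIndex X).VQ), Set ((logShellsDH X logv).Packet j vQ))
  (archSub : ∀ (j : (thetaIndex X).Label) (v : (thetaIndex X).V),
    Set ((logShellsDH X logv).Packet j ((thetaIndex X).over v)))
  (Ψ : ℤ → ∀ v : (thetaIndex X).V, v ∈ (thetaIndex X).Vbad → Set ((logShellsDH X logv).StarPacket v))
  (act : ℤ → ∀ v : (thetaIndex X).V, v ∈ (thetaIndex X).Vbad →
    (logShellsDH X logv).StarPacket v → Module.End ℚ ((logShellsDH X logv).StarPacket v))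
  (Mmod : ℤ → ∀ j : (thetaIndex X).LabelStar, Set ((logShellsDH X logv).GlobalPacket j.1))
  (region : ℤ → ∀ j : (thetaIndex X).LabelStar, FinDivisor M → ∀ vQ : (thetaIndex X).VQ,
    Set ((logShellsDH X logv).Packet j.1 vQ))
  (n : ℤ) {HT : Type} {LogLink : HT → HT → Type} {IsFull : ∀ {s t : HT}, LogLink s t → Prop}
  (lat : LGPGaussianLogThetaLattice LogLink IsFull)
  {Frd : Type} {IsoF : Frd → Frd → Type} {Ob : Frd → Type} {realify : Frd → Frd} {Strip : Type}
  {IsoS : Strip → Strip → Type} {Mv : ∀ v : (thetaIndex X).V, v ∈ (thetaIndex X).Vbad → Type}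
  [∀ v h, Monoid (Mv v h)]
  (sig : GlobalLGPFrobenioidSignature (thetaIndex X).lstar (thetaIndex X).V (· ∈ (thetaIndex X).Vbad)
    Frd IsoF Ob realify Strip IsoS Mv)
  (split : SplittingMonoids Mv) {ObΔ : Type} {N : ∀ v : (thetaIndex X).V, v ∈ (thetaIndex X).Vbad → Type}
  [∀ v h, Monoid (N v h)] (qData : QPilotData ObΔ N)
  (thetaBox : ℤ → Ob sig.Clgp → ∀ (j : (thetaIndex X).Label) (vQ : (thetaIndex X).VQ),
    Set (∀ s : factorIdxDH X hlog j vQ, factorFieldDH X hlog j vQ s))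
  (qCentre : ObΔ → ∀ (j : (thetaIndex X).Label) (vQ : (thetaIndex X).VQ),
    ∀ s : factorIdxDH X hlog j vQ, factorFieldDH X hlog j vQ s)
  (hq : ∀ j vQ s, qCentre (qPilotObject qData) j vQ s ≠ 0)
  (hfin : ∀ j : (thetaIndex X).Label, (Function.support fun vQ =>
    ((situationDHVol X hlog M archPk archSub Ψ act Mmod region).D n).logvol j vQ
      (factorMapDH X hlog j vQ ⁻¹' hullSet (factorFieldDH X hlog j vQ) (qCentre (qPilotObject qData) j vQ))).Finite)

/-- **`LogvolMono` PROVED for the assembled real setting with the verbatim volumes** ([IUTchIII] Prop. 3.9 (i):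
nonnegative weights, factorwise monotone log-measures; c312-5 `SummandPieces.logvolMono_of_realizes` on
`realizes_situationDHVol`). [claim: Mochizuki2012, status: disputed] -/
theorem logvolMono_settingDHVol :
    LogvolMono (settingDHVol X hlog M archPk archSub Ψ act Mmod region n lat sig split qData thetaBox qCentre hq
      hfin) :=
  SummandPieces.logvolMono_of_realizes (realizes_situationDHVol X hlog M archPk archSub Ψ act Mmod region _)

/-- **`ThetaRegionsAdm` at `Real.settingDHVol` from the shape of the Θ-boxes**: if every Θ-box of the Θ-pilot object at
`j ∈ 𝔽_l^⋇` is a hull-set `λ·𝒪_L = Π_{(v⃗,i)} λ_{v⃗,i}·𝒪_{L_{v⃗,i}}` of the field-factor packet ([IUTchIII] Rmk. 3.9.5 (ii)/(ix)),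
every Kummer image is admissible in the verbatim container — its preimage is a direct product over the summands of sets
of positive finite normalised Haar measure (c312-5 `hadm_DH`). [claim: Mochizuki2012, status: disputed] -/
theorem thetaRegionsAdm_settingDHVol_of_isHullSet
    (hbox : ∀ (m : ℤ) (i : Fin (thetaIndex X).lstar) (vQ : (thetaIndex X).VQ),
      IsHullSet (factorFieldDH X hlog _ vQ)
        (thetaBox m (thetaPilotObject sig split) (Setting.labelSucc i) vQ)) :
    ThetaRegionsAdm (settingDHVol X hlog M archPk archSub Ψ act Mmod region n lat sig split qData thetaBox
      qCentre hq hfin) :=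
  thetaRegionsAdm_ofComparison_of_isHullSet n lat sig split qData
    (realPiecesDH X hlog M archPk archSub Ψ act Mmod region thetaBox qCentre) hq
    (hadm_DH X hlog M archPk archSub Ψ act Mmod region n) hfin hbox

/-- **THE PRINTED STATEMENT OF [IUTchIII] COR. 3.12 AT `Real.settingDHVol`** (the real Dupuy–Hilado log-shells of
`F` with the VERBATIM weighted container) from exactly: (1) the Θ-boxes of the Θ-pilot object are hull-sets (shape of
the binder `thetaBox`; Rmk. 3.9.5 (ii)/(ix)), (2) `ThetaFinite` (= the Statement's own first conjunct «`−|log(Θ)| ∈ ℝ`»,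
reduced separately: abc-iut-c312-5 `Cor312ThetaFiniteDHVol`, c312-7 `hullDefined_of_stable`), (3) the per-packet B-INPUT
`VolumeTransport` (GAP-LEDGER G-c312-11-1 family). `LogvolMono`, `hadm`, `hul_nonempty` are PROVED at this setting
(c312-5 p414930 + `logvolMono_settingDHVol`); `hθ`/`hfinθ` do not occur. Nothing asserted; no side taken.
[claim: Mochizuki2012, status: disputed] -/
theorem statement_settingDHVol_of_volumeTransport
    (hbox : ∀ (m : ℤ) (i : Fin (thetaIndex X).lstar) (vQ : (thetaIndex X).VQ),
      IsHullSet (factorFieldDH X hlog _ vQ)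
        (thetaBox m (thetaPilotObject sig split) (Setting.labelSucc i) vQ))
    (finite : (settingDHVol X hlog M archPk archSub Ψ act Mmod region n lat sig split qData thetaBox qCentre hq
      hfin).ThetaFinite)
    (hvt : VolumeTransport (settingDHVol X hlog M archPk archSub Ψ act Mmod region n lat sig split qData thetaBox
      qCentre hq hfin)) :
    (settingDHVol X hlog M archPk archSub Ψ act Mmod region n lat sig split qData thetaBox qCentre hq
      hfin).Statement :=
  statement_of_volumeTransport_of_mono
    (logvolMono_settingDHVol X hlog M archPk archSub Ψ act Mmod region n lat sig split qData thetaBox qCentre hq hfin)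
    finite
    (thetaRegionsAdm_settingDHVol_of_isHullSet X hlog M archPk archSub Ψ act Mmod region n lat sig split qData
      thetaBox qCentre hq hfin hbox)
    hvt

/-- … from the uniform B-INPUT at ONE gluing position `m` (print: `m = 0`). [claim: Mochizuki2012, status: disputed] -/
theorem statement_settingDHVol_of_volumeTransportAt {m : ℤ}
    (hbox : ∀ (m : ℤ) (i : Fin (thetaIndex X).lstar) (vQ : (thetaIndex X).VQ),
      IsHullSet (factorFieldDH X hlog _ vQ)
        (thetaBox m (thetaPilotObject sig split) (Setting.labelSucc i) vQ))
    (finite : (settingDHVol X hlog M archPk archSub Ψ act Mmod region n lat sig split qData thetaBox qCentre hq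
      hfin).ThetaFinite)
    (hvt : VolumeTransportAt (settingDHVol X hlog M archPk archSub Ψ act Mmod region n lat sig split qData thetaBox
      qCentre hq hfin) m) :
    (settingDHVol X hlog M archPk archSub Ψ act Mmod region n lat sig split qData thetaBox qCentre hq
      hfin).Statement :=
  statement_settingDHVol_of_volumeTransport X hlog M archPk archSub Ψ act Mmod region n lat sig split qData thetaBox
    qCentre hq hfin hbox finite (volumeTransport_of_at hvt)

/-- **… from the GLOBAL B-INPUT `GlobalVolumeTransport`** (the (G1′)-admissible quantifier level, B1 p414039):
print-level composition at the real setting with the verbatim volumes; side conditions = {hull-set Θ-boxes,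
Statement.1}. [claim: Mochizuki2012, status: disputed] -/
theorem statement_settingDHVol_of_globalVolumeTransport
    (hbox : ∀ (m : ℤ) (i : Fin (thetaIndex X).lstar) (vQ : (thetaIndex X).VQ),
      IsHullSet (factorFieldDH X hlog _ vQ)
        (thetaBox m (thetaPilotObject sig split) (Setting.labelSucc i) vQ))
    (finite : (settingDHVol X hlog M archPk archSub Ψ act Mmod region n lat sig split qData thetaBox qCentre hq
      hfin).ThetaFinite)
    (hgvt : GlobalVolumeTransport (settingDHVol X hlog M archPk archSub Ψ act Mmod region n lat sig split qData
      thetaBox qCentre hq hfin)) :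
    (settingDHVol X hlog M archPk archSub Ψ act Mmod region n lat sig split qData thetaBox qCentre hq
      hfin).Statement :=
  statement_of_globalVolumeTransport_of_mono
    (logvolMono_settingDHVol X hlog M archPk archSub Ψ act Mmod region n lat sig split qData thetaBox qCentre hq hfin)
    finite
    (thetaRegionsAdm_settingDHVol_of_isHullSet X hlog M archPk archSub Ψ act Mmod region n lat sig split qData
      thetaBox qCentre hq hfin hbox)
    hgvt

/-- … uniform global form at ONE position `m₀`. [claim: Mochizuki2012, status: disputed] -/
theorem statement_settingDHVol_of_globalVolumeTransportAt {m₀ : ℤ}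
    (hbox : ∀ (m : ℤ) (i : Fin (thetaIndex X).lstar) (vQ : (thetaIndex X).VQ),
      IsHullSet (factorFieldDH X hlog _ vQ)
        (thetaBox m (thetaPilotObject sig split) (Setting.labelSucc i) vQ))
    (finite : (settingDHVol X hlog M archPk archSub Ψ act Mmod region n lat sig split qData thetaBox qCentre hq
      hfin).ThetaFinite)
    (h : GlobalVolumeTransportAt (settingDHVol X hlog M archPk archSub Ψ act Mmod region n lat sig split qData
      thetaBox qCentre hq hfin) m₀) :
    (settingDHVol X hlog M archPk archSub Ψ act Mmod region n lat sig split qData thetaBox qCentre hq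
      hfin).Statement :=
  statement_settingDHVol_of_globalVolumeTransport X hlog M archPk archSub Ψ act Mmod region n lat sig split qData
    thetaBox qCentre hq hfin hbox finite (globalVolumeTransport_of_at h)

/-- Census at this setting, kernel form: the per-packet B-INPUT also yields the GLOBAL one with its support condition
DERIVED (so the two inputs above are one family here), from hull-set Θ-boxes + Statement.1 alone. [folklore] -/
theorem globalVolumeTransport_settingDHVol_of_volumeTransport
    (hbox : ∀ (m : ℤ) (i : Fin (thetaIndex X).lstar) (vQ : (thetaIndex X).VQ),
      IsHullSet (factorFieldDH X hlog _ vQ)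
        (thetaBox m (thetaPilotObject sig split) (Setting.labelSucc i) vQ))
    (finite : (settingDHVol X hlog M archPk archSub Ψ act Mmod region n lat sig split qData thetaBox qCentre hq
      hfin).ThetaFinite)
    (hvt : VolumeTransport (settingDHVol X hlog M archPk archSub Ψ act Mmod region n lat sig split qData thetaBox
      qCentre hq hfin)) :
    GlobalVolumeTransport (settingDHVol X hlog M archPk archSub Ψ act Mmod region n lat sig split qData thetaBox
      qCentre hq hfin) :=
  globalVolumeTransport_of_volumeTransport_of_mono
    (logvolMono_settingDHVol X hlog M archPk archSub Ψ act Mmod region n lat sig split qData thetaBox qCentre hq hfin)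
    finite
    (thetaRegionsAdm_settingDHVol_of_isHullSet X hlog M archPk archSub Ψ act Mmod region n lat sig split qData
      thetaBox qCentre hq hfin hbox)
    hvt

end Real

end Thm311

end IUTFork

end Summit.ABC

end
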